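import Literature.MathematicalPhysics.QuantumLattice.YangMillsHeatFlowBochner
import Literature.MathematicalPhysics.QuantumLattice.YangMillsHeatFlowWeightedEnergy
import HarnessLib

/-!
# Evolution of `D^*F` under the Yang–Mills heat flow and the Bochner inequality for `|D^*F|²`

QuantumLattice support file (everything proved; no definitions, no named facts) on the proof
path of `Literature.MathematicalPhysics.QuantumLattice.Waldron2019_yangMillsFlow_flatTorus`
(A. Waldron, *Long-time existence for Yang–Mills flow*, Invent. math. 217 (2019), Thm 1.1 /
Cor. 1.2), §3: the `D^*F`-half of the `ε`-regularity Proposition 3.1(b), after [instantons]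
(Waldron 2016) Lemma 3.5: *"One computes the evolution `(∂ₜ + ∇^*∇) D^*F_i = 2[F_{ij}, D^*F_j]
+ Rm # D^*F_j`. The estimate then follows again from Moser iteration."* On flat space `Rm = 0`.

For a jointly smooth solution `∂ₜA = div_A F_A` (`= −D^*F`; `div F(w) = ∑ᵢ D_{bᵢ}F(bᵢ, w)`) on an
open time set `𝒯`, writing `Ȧ_w = div F(w)`:

* `hasDerivAt_fderiv_timeSlice'`, `hasDerivAt_covDeriv_timeSlice` — mixed partials and the time
  derivative of a covariant derivative `∂ₜ(D_v Φ) = D_v(∂ₜΦ) + [Ȧ_v, Φ]` (joint `C²` data);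
* `sum_covDeriv_divCurvature_eq_zero` — `∑ᵢ D_{bᵢ}(div F)(bᵢ) = 0` (`D^*D^*F = 0`, from
  `[D_i, D_j] = [F_{ij}, ·]` and antisymmetry);
* `hasDerivAt_divCurvature_of_flow` — **the evolution of `D^*F`**:
  `∂ₜ Ȧ_w = ∑ᵢ D_{bᵢ}D_{bᵢ} Ȧ_w + 2 ∑ᵢ [F(w, bᵢ), Ȧ_{bᵢ}]`;
* `deriv_divDensity_sub_laplacian_le` — **the Bochner inequality** for
  `u = ∑ⱼ ‖Ȧ_{bⱼ}‖²`: `∂ₜu − ∑ᵢ∂ᵢ∂ᵢu ≤ −2∑ᵢⱼ‖DᵢȦⱼ‖² + 8√2 (card ι) √e · u`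
  (`e = ymDensityOfBasis`), a LINEAR differential inequality once `|F|` is bounded.

References: A. Waldron, Invent. math. 217 (2019), Prop. 3.1(b) [Waldron2019]; A. Waldron,
Calc. Var. PDE 55 (2016) = arXiv:1402.3224, Lemma 3.5 [Waldron2016]; Donaldson–Kronheimer,
*The Geometry of Four-Manifolds*, §2.1.2, (2.1.21), §6.2.3 [DonaldsonKronheimer1990].
-/

noncomputable section

open scoped ContDiff Topology RealInnerProductSpace Matrix
open Set Filter

namespace Literature.MathematicalPhysics.QuantumLattice

/-! ### Mixed partials and time derivatives of covariant derivatives -/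

section TimeDerivatives

variable {E : Type*} [NormedAddCommGroup E] [InnerProductSpace ℝ E]
variable {𝔸 : Type*} [NormedRing 𝔸] [NormedAlgebra ℝ 𝔸]
variable {F' : Type*} [NormedAddCommGroup F'] [NormedSpace ℝ F']

/-- Finite differentiability orders are below `∞`. [folklore] -/
private theorem natCast_le_infty₆ (n : ℕ) : (n : WithTop ℕ∞) ≤ ∞ := by exact_mod_cast le_top

omit [InnerProductSpace ℝ E] in
/-- Time derivative of a slice of a jointly differentiable map `Φ` on an open set `U ∋ (t, x)`:
`∂ₜ Φ(·, x)(t) = DΦ(t,x)[(1,0)]`. [folklore] -/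
theorem hasDerivAt_timeSlice [NormedSpace ℝ E] {n : WithTop ℕ∞} {Φ : ℝ × E → F'}
    {U : Set (ℝ × E)} (hU : IsOpen U) (hΦ : ContDiffOn ℝ n Φ U) (hn : n ≠ 0)
    {t : ℝ} {x : E} (hp : (t, x) ∈ U) :
    HasDerivAt (fun s => Φ (s, x)) (fderiv ℝ Φ (t, x) ((1 : ℝ), (0 : E))) t := by
  have hd : HasFDerivAt Φ (fderiv ℝ Φ (t, x)) (t, x) :=
    ((hΦ.differentiableOn hn).differentiableAt (hU.mem_nhds hp)).hasFDerivAt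
  have hcurve : HasDerivAt (fun s : ℝ => ((s, x) : ℝ × E)) ((1 : ℝ), (0 : E)) t :=
    (hasDerivAt_id t).prodMk (hasDerivAt_const t x)
  have h := hd.comp_hasDerivAt t hcurve
  simpa [Function.comp_def] using h

omit [InnerProductSpace ℝ E] in
/-- Spatial derivative of a slice: `∂_u Φ(t, ·)(x) = DΦ(t,x)[(0,u)]`. [folklore] -/
theorem fderiv_spaceSlice_apply [NormedSpace ℝ E] {n : WithTop ℕ∞} {Φ : ℝ × E → F'}
    {U : Set (ℝ × E)} (hU : IsOpen U) (hΦ : ContDiffOn ℝ n Φ U) (hn : n ≠ 0)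
    {t : ℝ} {x : E} (hp : (t, x) ∈ U) (u : E) :
    fderiv ℝ (fun y => Φ (t, y)) x u = fderiv ℝ Φ (t, x) ((0 : ℝ), u) := by
  have hd : HasFDerivAt Φ (fderiv ℝ Φ (t, x)) (t, x) :=
    ((hΦ.differentiableOn hn).differentiableAt (hU.mem_nhds hp)).hasFDerivAt
  have hemb : HasFDerivAt (fun y : E => ((t, y) : ℝ × E))
      ((0 : E →L[ℝ] ℝ).prod (ContinuousLinearMap.id ℝ E)) x :=
    (hasFDerivAt_const t x).prodMk (hasFDerivAt_id x)
  have h : HasFDerivAt (fun y : E => Φ (t, y))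
      ((fderiv ℝ Φ (t, x)).comp ((0 : E →L[ℝ] ℝ).prod (ContinuousLinearMap.id ℝ E))) x := by
    have h := hd.comp x hemb
    simpa [Function.comp_def] using h
  rw [h.fderiv]
  simp

omit [InnerProductSpace ℝ E] in
/-- **Mixed partials commute** for a jointly `C²` map `Φ` on an open set `U ∋ (t, x)`: the time
derivative of `s ↦ ∂_u Φ(s, ·)(x)` at `t` is `∂_u (∂ₜΦ(t, ·))(x)`. [folklore] -/
theorem hasDerivAt_fderiv_timeSlice' [NormedSpace ℝ E] {n : WithTop ℕ∞} {Φ : ℝ × E → F'}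
    {U : Set (ℝ × E)} (hU : IsOpen U) (hΦ : ContDiffOn ℝ n Φ U) (hn : 2 ≤ n)
    {t : ℝ} {x : E} (hp : (t, x) ∈ U) (u : E) :
    HasDerivAt (fun s => fderiv ℝ (fun y => Φ (s, y)) x u)
      (fderiv ℝ (fun y => fderiv ℝ Φ (t, y) ((1 : ℝ), (0 : E))) x u) t := by
  have hn0 : n ≠ 0 := by
    rintro rfl
    exact (not_le.mpr (by exact_mod_cast (by norm_num : (0:ℕ) < 2) : (0 : WithTop ℕ∞) < 2)) hn
  have hn1 : (1 : WithTop ℕ∞) ≤ n := le_trans (by exact_mod_cast (by norm_num : (1:ℕ) ≤ 2)) hn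
  -- `DΦ` is `C^{n-1}`, hence differentiable, on `U`
  have hΦ' : ContDiffOn ℝ (n - 1) (fderiv ℝ Φ) U :=
    hΦ.fderiv_of_isOpen hU (m := n - 1) (by simpa using (tsub_add_cancel_of_le hn1).le)
  have hn1' : n - 1 ≠ 0 := by
    intro h
    have : n ≤ 1 := tsub_eq_zero_iff_le.mp h
    exact absurd (le_trans hn this) (by exact_mod_cast (by norm_num : ¬ ((2:ℕ) ≤ 1)))
  have hdiff' : DifferentiableOn ℝ (fderiv ℝ Φ) U := hΦ'.differentiableOn hn1'
  -- symmetry of the second derivative at `(t, x)`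
  have hsymm : IsSymmSndFDerivAt ℝ Φ (t, x) :=
    (hΦ.contDiffAt (hU.mem_nhds hp)).isSymmSndFDerivAt (by simpa using hn)
  -- the left-hand side near `t`, through the joint derivative
  have hev : ∀ᶠ s in 𝓝 t, fderiv ℝ (fun y => Φ (s, y)) x u = fderiv ℝ Φ (s, x) ((0 : ℝ), u) := by
    have hsec : ∀ᶠ s in 𝓝 t, (s, x) ∈ U := by
      have : Continuous fun s : ℝ => ((s, x) : ℝ × E) := continuous_id.prodMk continuous_const
      exact this.continuousAt.preimage_mem_nhds (hU.mem_nhds hp)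
    filter_upwards [hsec] with s hs
    exact fderiv_spaceSlice_apply hU hΦ hn0 hs u
  -- derivative of `s ↦ DΦ(s, x)[(0,u)]` (an `F'`-valued map) in `s`
  set V : ℝ × E := ((0 : ℝ), u) with hV
  have hG : DifferentiableOn ℝ (fun p : ℝ × E => fderiv ℝ Φ p V) U := fun p hp' =>
    (hdiff' p hp').clm_apply (differentiableWithinAt_const V)
  have hGc : ContDiffOn ℝ (n - 1) (fun p : ℝ × E => fderiv ℝ Φ p V) U :=
    hΦ'.clm_apply contDiffOn_const
  have h2 : HasDerivAt (fun s : ℝ => fderiv ℝ Φ (s, x) V)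
      (fderiv ℝ (fun p : ℝ × E => fderiv ℝ Φ p V) (t, x) ((1 : ℝ), (0 : E))) t :=
    hasDerivAt_timeSlice hU hGc hn1' hp
  have hval2 : fderiv ℝ (fun p : ℝ × E => fderiv ℝ Φ p V) (t, x) ((1 : ℝ), (0 : E)) =
      fderiv ℝ (fderiv ℝ Φ) (t, x) ((1 : ℝ), (0 : E)) V := by
    rw [fderiv_clm_apply ((hdiff' _ hp).differentiableAt (hU.mem_nhds hp))
      (differentiableAt_const V)]
    simp
  -- the right-hand side: `∂_u` of `y ↦ DΦ(t, y)[(1,0)]`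
  set W : ℝ × E := ((1 : ℝ), (0 : E)) with hW
  have hHc : ContDiffOn ℝ (n - 1) (fun p : ℝ × E => fderiv ℝ Φ p W) U :=
    hΦ'.clm_apply contDiffOn_const
  have hR : fderiv ℝ (fun y => fderiv ℝ Φ (t, y) W) x u =
      fderiv ℝ (fderiv ℝ Φ) (t, x) V W := by
    rw [fderiv_spaceSlice_apply hU hHc hn1' hp u,
      fderiv_clm_apply ((hdiff' _ hp).differentiableAt (hU.mem_nhds hp))
        (differentiableAt_const W)]
    simp [hV]
  rw [hR, hsymm.eq V W, ← hval2]
  exact h2.congr_of_eventuallyEq hev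

/-- **Time derivative of a covariant derivative.** Let `A` be a time-dependent connection and
`Φ` an `𝔸`-valued field, both jointly `C²` on an open set `U ∋ (t, x)`. Then
`∂ₜ (D_{A(s)} Φ(s, ·))(x)(v) = D_{A(t)} (∂ₜΦ(t, ·))(x)(v) + [Ȧ_v(t, x), Φ(t, x)]`, where
`∂ₜΦ(t, y) = DΦ(t,y)[(1,0)]` and `Ȧ_v(t, x) = DĀ(t,x)[(1,0)] v`. [folklore] -/
theorem hasDerivAt_covDeriv_timeSlice {n : WithTop ℕ∞} {A : ℝ → Connection E 𝔸}
    {Φ : ℝ × E → 𝔸} {U : Set (ℝ × E)} (hU : IsOpen U)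
    (hA : ContDiffOn ℝ n (fun p : ℝ × E => A p.1 p.2) U) (hΦ : ContDiffOn ℝ n Φ U) (hn : 2 ≤ n)
    {t : ℝ} {x : E} (hp : (t, x) ∈ U) (v : E) :
    HasDerivAt (fun s => covDeriv (A s) (fun y => Φ (s, y)) x v)
      (covDeriv (A t) (fun y => fderiv ℝ Φ (t, y) ((1 : ℝ), (0 : E))) x v +
        ⁅fderiv ℝ (fun p : ℝ × E => A p.1 p.2) (t, x) ((1 : ℝ), (0 : E)) v, Φ (t, x)⁆) t := by
  have hn0 : n ≠ 0 := by
    rintro rfl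
    exact (not_le.mpr (by exact_mod_cast (by norm_num : (0:ℕ) < 2) : (0 : WithTop ℕ∞) < 2)) hn
  have h1 := hasDerivAt_fderiv_timeSlice' hU hΦ hn hp v
  have h2 := hasDerivAt_slice_apply hU hA hn0 hp v
  have h3 := hasDerivAt_timeSlice hU hΦ hn0 hp
  have hF : (fun s => covDeriv (A s) (fun y => Φ (s, y)) x v) = fun s =>
      fderiv ℝ (fun y => Φ (s, y)) x v + (A s x v * Φ (s, x) - Φ (s, x) * A s x v) := by
    funext s
    simp only [covDeriv, Ring.lie_def]
  rw [hF]
  have h := h1.add ((h2.mul h3).sub (h3.mul h2))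
  refine h.congr_deriv ?_
  simp only [covDeriv, Ring.lie_def]
  noncomm_ring

end TimeDerivatives

/-! ### `D^* D^* F = 0` and the evolution of `D^*F` -/

section DivEvolution

variable {E : Type*} [NormedAddCommGroup E] [InnerProductSpace ℝ E]
variable {𝔸 : Type*} [NormedRing 𝔸] [NormedAlgebra ℝ 𝔸]
variable {ι : Type*} [Fintype ι]

/-- `D_u(φ − ψ) = D_uφ − D_uψ` for sections differentiable at the point. [folklore] -/
theorem covDeriv_fun_sub (A : Connection E 𝔸) {φ ψ : E → 𝔸} {x : E}
    (hφ : DifferentiableAt ℝ φ x) (hψ : DifferentiableAt ℝ ψ x) (u : E) :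
    covDeriv A (fun y => φ y - ψ y) x u = covDeriv A φ x u - covDeriv A ψ x u := by
  simp only [covDeriv, fderiv_fun_sub hφ hψ, sub_apply, Ring.lie_def, mul_sub, sub_mul]
  abel

/-- The covariant derivative of the zero section vanishes. [folklore] -/
@[simp] theorem covDeriv_fun_zero (A : Connection E 𝔸) (x u : E) :
    covDeriv A (fun _ => (0 : 𝔸)) x u = 0 := by
  simp [covDeriv, Ring.lie_def]

/-- **`D^* D^* F = 0`** on flat space: for a `C³` connection and an orthonormal frame `b`,
`∑ᵢ D_{bᵢ} (div F)(bᵢ) = 0`, where `div F(w) = ∑ⱼ D_{bⱼ} F(bⱼ, w)` (pair the `(i, j)` and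
`(j, i)` terms: `DᵢDⱼF_{ji} + DⱼDᵢF_{ij} = [Fᵢⱼ, F_{ji}] = 0` by the commutator formula and
antisymmetry). Donaldson–Kronheimer §2.1.2. [folklore] -/
theorem sum_covDeriv_divCurvature_eq_zero (b : OrthonormalBasis ι ℝ E) (A : Connection E 𝔸)
    (hA : ContDiff ℝ 3 A) (x : E) :
    ∑ i, covDeriv A (fun y => ∑ j, covDeriv A (fun z => curvature A z (b j) (b i)) y (b j)) x
      (b i) = 0 := by
  have hA1 : ContDiff ℝ 1 A := hA.of_le (by norm_num)
  have hA21 : ContDiff ℝ (2 + 1) A := by rw [show (2 : WithTop ℕ∞) + 1 = 3 by norm_num]; exact hA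
  have hA12 : ContDiff ℝ (1 + 2) A := by rw [show (1 : WithTop ℕ∞) + 2 = 3 by norm_num]; exact hA
  have hG2 : ∀ a c, ContDiff ℝ 2 (fun y => curvature A y a c) := fun a c =>
    contDiff_curvature_apply hA21 a c
  have hDG : ∀ a c w, Differentiable ℝ fun y => covDeriv A (fun z => curvature A z a c) y w :=
    fun a c w => (contDiff_covDeriv_curvature_apply (k := 1) hA12 a c w).differentiable one_ne_zero
  set T : ι → ι → 𝔸 := fun i j =>
    covDeriv A (fun y => covDeriv A (fun z => curvature A z (b j) (b i)) y (b j)) x (b i) with hT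
  have hlin : ∀ i, covDeriv A (fun y => ∑ j, covDeriv A (fun z => curvature A z (b j) (b i)) y
      (b j)) x (b i) = ∑ j, T i j := fun i =>
    covDeriv_fun_sum Finset.univ A (fun j _ => hDG (b j) (b i) (b j) x) (b i)
  -- the pairing `T i j + T j i = 0`
  have hneg : ∀ i j, T j i =
      -covDeriv A (fun y => covDeriv A (fun z => curvature A z (b j) (b i)) y (b i)) x (b j) := by
    intro i j
    simp only [hT]
    have hin : (fun y => covDeriv A (fun z => curvature A z (b i) (b j)) y (b i)) =
        fun y => -covDeriv A (fun z => curvature A z (b j) (b i)) y (b i) := by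
      funext y
      rw [show (fun z => curvature A z (b i) (b j)) = fun z => -curvature A z (b j) (b i) from
        funext fun z => curvature_antisymm A z (b i) (b j), covDeriv_fun_neg]
    rw [hin, covDeriv_fun_neg]
  have hpair : ∀ i j, T i j + T j i = 0 := by
    intro i j
    have hcomm := covDeriv_covDeriv_sub_eq_lie A hA1 (hG2 (b j) (b i)) x (b i) (b j)
    rw [hneg i j, ← sub_eq_add_neg, hT, hcomm, curvature_antisymm A x (b i) (b j), Ring.lie_def]
    noncomm_ring
  -- `2 S = ∑ᵢⱼ (T i j + T j i) = 0`
  have hS : ∑ i, ∑ j, T i j = 0 := by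
    have h2 : (2 : ℝ) • ∑ i, ∑ j, T i j = 0 := by
      rw [two_smul]
      conv_lhs => rw [show (∑ i, ∑ j, T i j) + ∑ i, ∑ j, T i j =
        (∑ i, ∑ j, T i j) + ∑ i, ∑ j, T j i by rw [Finset.sum_comm (f := fun i j => T j i)]]
      rw [← Finset.sum_add_distrib]
      refine Finset.sum_eq_zero fun i _ => ?_
      rw [← Finset.sum_add_distrib]
      exact Finset.sum_eq_zero fun j _ => hpair i j
    exact (smul_eq_zero.1 h2).resolve_left two_ne_zero
  simpa only [hlin] using hS

variable [FiniteDimensional ℝ E]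

/-- **Evolution of `D^*F` under the Yang–Mills heat flow** (flat space). Let `A` be jointly
smooth on `𝒯 × E` (`𝒯` open) and solve `∂ₜA = div_A F_A` on `𝒯`. Then for `t ∈ 𝒯`, every `x`
and `w`, in any orthonormal frame `b`,
`∂ₜ (div F)(x)(w) = ∑ᵢ D_{bᵢ}D_{bᵢ}(div F(w))(x) + 2 ∑ᵢ [F(x)(w, bᵢ), div F(x)(bᵢ)]`
— Waldron's `(∂ₜ + ∇^*∇) D^*F_i = 2[F_{ij}, D^*F_j]` (`Rm = 0`): differentiate
`∑ᵢ D_{bᵢ}F(bᵢ,w)` in time (`∂ₜD = D∂ₜ + [Ȧ, ·]`, `∂ₜF = DȦ`), commute `DᵢD_w = D_wDᵢ + [F_{iw}, ·]`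
and use `D^*D^*F = 0`. [cite: Waldron2016, Lemma 3.5; Waldron2019, Prop. 3.1(b)] -/
theorem hasDerivAt_divCurvature_of_flow (b : OrthonormalBasis ι ℝ E)
    {A : ℝ → Connection E 𝔸} {𝒯 : Set ℝ} (h𝒯 : IsOpen 𝒯)
    (hA : ContDiffOn ℝ ∞ (fun p : ℝ × E => A p.1 p.2) (𝒯 ×ˢ (univ : Set E)))
    (hpde : ∀ ⦃s : ℝ⦄, s ∈ 𝒯 → ∀ y w, deriv (fun s' => A s' y w) s = divCurvature (A s) y w)
    {t : ℝ} (ht : t ∈ 𝒯) (x w : E) :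
    HasDerivAt (fun s => divCurvature (A s) x w)
      (∑ i, covDeriv (A t) (fun y => covDeriv (A t) (fun z => divCurvature (A t) z w) y (b i)) x
          (b i) + (2 : ℝ) • ∑ i, ⁅curvature (A t) x w (b i), divCurvature (A t) x (b i)⁆) t := by
  have hU : IsOpen (𝒯 ×ˢ (univ : Set E)) := h𝒯.prod isOpen_univ
  have hp : ∀ y, (t, y) ∈ 𝒯 ×ˢ (univ : Set E) := fun y => ⟨ht, mem_univ y⟩
  set Ā : ℝ × E → E →L[ℝ] 𝔸 := fun p => A p.1 p.2 with hĀ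
  have hsm : ∀ {s}, s ∈ 𝒯 → ContDiff ℝ ∞ (A s) := fun hs => contDiff_slice_of_contDiffOn_prod hA hs
  have hA3 : ContDiff ℝ 3 (A t) := (hsm ht).of_le (natCast_le_infty₆ 3)
  have hA2 : ∀ {s}, s ∈ 𝒯 → ContDiff ℝ 2 (A s) := fun hs => (hsm hs).of_le (natCast_le_infty₆ 2)
  have hA1 : ContDiff ℝ 1 (A t) := (hsm ht).of_le (natCast_le_infty₆ 1)
  -- ### the time derivative `𝒜 = Ȧ(t)` and the equation `𝒜 = div F`
  set 𝒜 : E → E → 𝔸 := fun y v => fderiv ℝ Ā (t, y) ((1 : ℝ), (0 : E)) v with h𝒜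
  have hdiv : ∀ y v, divCurvature (A t) y v = 𝒜 y v := fun y v => by
    rw [← hpde ht y v]
    exact (hasDerivAt_slice_apply hU hA (by simp) (hp y) v).deriv
  have hdivfun : ∀ v, (fun y => 𝒜 y v) = fun y => divCurvature (A t) y v := fun v =>
    funext fun y => (hdiv y v).symm
  -- regularity of `y ↦ div F(y)(v)` and of `𝒜`
  have hA22 : ContDiff ℝ (2 + 2) (A t) := by
    rw [show (2 : WithTop ℕ∞) + 2 = 4 by norm_num]; exact (hsm ht).of_le (natCast_le_infty₆ 4)
  have hdivC : ∀ v, ContDiff ℝ 2 (fun y => divCurvature (A t) y v) := fun v =>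
    contDiff_divCurvature_apply hA22 v
  have h𝒜2 : ∀ v, ContDiff ℝ 2 (fun y => 𝒜 y v) := fun v => by rw [hdivfun v]; exact hdivC v
  have h𝒜d : ∀ v y, DifferentiableAt ℝ (fun y => 𝒜 y v) y := fun v y =>
    ((h𝒜2 v).differentiable two_ne_zero) y
  have hD𝒜d : ∀ v u y, DifferentiableAt ℝ (fun y => covDeriv (A t) (fun z => 𝒜 z v) y u) y :=
    fun v u y => differentiableAt_covDeriv_apply hA1 (h𝒜2 v) u y
  -- ### Step 1: the frame formula for `div F(s)` near `t`
  have hev : (fun s => divCurvature (A s) x w) =ᶠ[𝓝 t]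
      fun s => ∑ i, covDeriv (A s) (fun z => curvature (A s) z (b i) w) x (b i) := by
    filter_upwards [h𝒯.mem_nhds ht] with s hs
    exact divCurvature_eq_sum_orthonormalBasis b (A s) (hA2 hs) x w
  -- ### Step 2: differentiate each `D_{bᵢ} F(bᵢ, w)` in time
  have hΦ : ∀ i, ContDiffOn ℝ ∞ (fun p : ℝ × E => curvature (A p.1) p.2 (b i) w)
      (𝒯 ×ˢ (univ : Set E)) := fun i =>
    contDiffOn_curvature_joint hU hA (m := ∞) (by norm_cast) (b i) w
  -- `∂ₜ F(bᵢ, w)(t, y) = D_{bᵢ} 𝒜_w(y) − D_w 𝒜_{bᵢ}(y)`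
  have hFt : ∀ i y, fderiv ℝ (fun p : ℝ × E => curvature (A p.1) p.2 (b i) w) (t, y)
      ((1 : ℝ), (0 : E)) =
      covDeriv (A t) (fun z => 𝒜 z w) y (b i) - covDeriv (A t) (fun z => 𝒜 z (b i)) y w := by
    intro i y
    have h1 := hasDerivAt_timeSlice hU (hΦ i) (by simp) (hp y)
    have h2 := hasDerivAt_curvature_slice hU hA (natCast_le_infty₆ 2) (hp y) (b i) w
    exact h1.unique h2
  have hterm : ∀ i, HasDerivAt (fun s => covDeriv (A s) (fun z => curvature (A s) z (b i) w) x (b i))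
      (covDeriv (A t) (fun y => covDeriv (A t) (fun z => 𝒜 z w) y (b i) -
          covDeriv (A t) (fun z => 𝒜 z (b i)) y w) x (b i) + ⁅𝒜 x (b i), curvature (A t) x (b i) w⁆)
      t := by
    intro i
    have h := hasDerivAt_covDeriv_timeSlice hU hA (hΦ i) (natCast_le_infty₆ 2) (hp x) (b i)
    have heq : (fun y => fderiv ℝ (fun p : ℝ × E => curvature (A p.1) p.2 (b i) w) (t, y)
        ((1 : ℝ), (0 : E))) = fun y => covDeriv (A t) (fun z => 𝒜 z w) y (b i) -
          covDeriv (A t) (fun z => 𝒜 z (b i)) y w := funext (hFt i)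
    rw [heq] at h
    exact h
  have hsum := HasDerivAt.fun_sum (u := Finset.univ) fun i _ => hterm i
  refine (hsum.congr_of_eventuallyEq hev).congr_deriv ?_
  -- ### Step 3: algebra
  -- `Dᵢ(Dᵢ𝒜_w − D_w𝒜ᵢ) = DᵢDᵢ𝒜_w − DᵢD_w𝒜ᵢ`
  have hsub : ∀ i, covDeriv (A t) (fun y => covDeriv (A t) (fun z => 𝒜 z w) y (b i) -
      covDeriv (A t) (fun z => 𝒜 z (b i)) y w) x (b i) =
      covDeriv (A t) (fun y => covDeriv (A t) (fun z => 𝒜 z w) y (b i)) x (b i) -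
        covDeriv (A t) (fun y => covDeriv (A t) (fun z => 𝒜 z (b i)) y w) x (b i) := fun i =>
    covDeriv_fun_sub (A t) (hD𝒜d w (b i) x) (hD𝒜d (b i) w x) (b i)
  -- `DᵢD_w𝒜ᵢ = D_wDᵢ𝒜ᵢ + [F(bᵢ, w), 𝒜ᵢ]`
  have hcomm : ∀ i, covDeriv (A t) (fun y => covDeriv (A t) (fun z => 𝒜 z (b i)) y w) x (b i) =
      covDeriv (A t) (fun y => covDeriv (A t) (fun z => 𝒜 z (b i)) y (b i)) x w +
        ⁅curvature (A t) x (b i) w, 𝒜 x (b i)⁆ := by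
    intro i
    have h := covDeriv_covDeriv_sub_eq_lie (A t) hA1 (h𝒜2 (b i)) x (b i) w
    rw [sub_eq_iff_eq_add] at h
    rw [h, add_comm]
  -- `∑ᵢ D_wDᵢ𝒜ᵢ = D_w(∑ᵢ Dᵢ𝒜ᵢ) = D_w 0 = 0`
  have hzero : (fun y => ∑ i, covDeriv (A t) (fun z => 𝒜 z (b i)) y (b i)) = fun _ => (0 : 𝔸) := by
    funext y
    have h0 := sum_covDeriv_divCurvature_eq_zero b (A t) hA3 y
    rw [← h0]
    refine Finset.sum_congr rfl fun i _ => ?_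
    rw [hdivfun (b i)]
    congr 1
    funext z
    exact divCurvature_eq_sum_orthonormalBasis b (A t) (hA2 ht) z (b i)
  have hDw : ∑ i, covDeriv (A t) (fun y => covDeriv (A t) (fun z => 𝒜 z (b i)) y (b i)) x w = 0 := by
    rw [← covDeriv_fun_sum Finset.univ (A t) (fun i _ => hD𝒜d (b i) (b i) x) w]
    simp only [hzero, covDeriv_fun_zero]
  -- assemble
  have hdiv' : ∀ y v, 𝒜 y v = divCurvature (A t) y v := fun y v => (hdiv y v).symm
  have hS1 : ∑ i, covDeriv (A t) (fun y => covDeriv (A t) (fun z => 𝒜 z w) y (b i) -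
      covDeriv (A t) (fun z => 𝒜 z (b i)) y w) x (b i) =
      ∑ i, covDeriv (A t) (fun y => covDeriv (A t) (fun z => 𝒜 z w) y (b i)) x (b i) -
        ∑ i, ⁅curvature (A t) x (b i) w, 𝒜 x (b i)⁆ := by
    simp only [hsub, hcomm, Finset.sum_sub_distrib, Finset.sum_add_distrib, hDw, zero_add]
  rw [Finset.sum_add_distrib, hS1]
  simp only [hdiv']
  have hbr : ∀ i, -⁅curvature (A t) x (b i) w, divCurvature (A t) x (b i)⁆ +
      ⁅divCurvature (A t) x (b i), curvature (A t) x (b i) w⁆ =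
      (2 : ℝ) • ⁅curvature (A t) x w (b i), divCurvature (A t) x (b i)⁆ := by
    intro i
    rw [curvature_antisymm (A t) x (b i) w, Ring.lie_def, Ring.lie_def, Ring.lie_def, two_smul]
    noncomm_ring
  rw [sub_eq_add_neg, add_assoc, ← Finset.sum_neg_distrib, ← Finset.sum_add_distrib,
    Finset.smul_sum]
  congr 1
  exact Finset.sum_congr rfl fun i _ => hbr i

end DivEvolution

/-! ### The Bochner inequality for `|D^*F|²` -/

section DivBochner

open scoped Matrix.Norms.Frobenius

attribute [local instance] frobeniusInnerProductSpace

variable {m : Type*} [Fintype m] [DecidableEq m]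
variable {E : Type*} [NormedAddCommGroup E] [InnerProductSpace ℝ E] [FiniteDimensional ℝ E]
variable {ι : Type*} [Fintype ι] [LinearOrder ι]

omit [DecidableEq m] in
/-- The derivative of a curve with values in a closed submodule lies in the submodule.
[folklore] -/
theorem mem_submodule_of_hasDerivAt {V : Type*} [NormedAddCommGroup V] [NormedSpace ℝ V]
    {K : Submodule ℝ V} (hK : IsClosed (K : Set V)) {f : ℝ → V} {f' : V} {t : ℝ}
    (hf : HasDerivAt f f' t) (hmem : ∀ᶠ s in 𝓝 t, f s ∈ K) : f' ∈ K := by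
  have htend : Tendsto (slope f t) (𝓝[≠] t) (𝓝 f') := hasDerivAt_iff_tendsto_slope.1 hf
  have ht : f t ∈ K := hmem.self_of_nhds
  have hslope : ∀ᶠ s in 𝓝[≠] t, slope f t s ∈ (K : Set V) := by
    filter_upwards [nhdsWithin_le_nhds hmem] with s hs
    rw [slope_def_module]
    exact K.smul_mem _ (K.sub_mem hs ht)
  exact hK.mem_of_tendsto htend hslope

/-- Along a `𝔲(m)`-valued solution of the Yang–Mills heat equation, `div F = ∂ₜA` is
`𝔲(m)`-valued. [folklore] -/
theorem divCurvature_mem_skewAdjoint_of_flow {A : ℝ → Connection E (Matrix m m ℂ)} {𝒯 : Set ℝ}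
    (h𝒯 : IsOpen 𝒯) (hA : ContDiffOn ℝ ∞ (fun p : ℝ × E => A p.1 p.2) (𝒯 ×ˢ (univ : Set E)))
    (hval : ∀ ⦃s : ℝ⦄, s ∈ 𝒯 → (A s).IsValuedIn (skewAdjoint.submodule ℝ (Matrix m m ℂ)))
    (hpde : ∀ ⦃s : ℝ⦄, s ∈ 𝒯 → ∀ y w, deriv (fun s' => A s' y w) s = divCurvature (A s) y w)
    {t : ℝ} (ht : t ∈ 𝒯) (y w : E) :
    divCurvature (A t) y w ∈ skewAdjoint.submodule ℝ (Matrix m m ℂ) := by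
  have hU : IsOpen (𝒯 ×ˢ (univ : Set E)) := h𝒯.prod isOpen_univ
  have hd := hasDerivAt_slice_apply hU hA (by simp) (⟨ht, mem_univ y⟩ : (t, y) ∈ 𝒯 ×ˢ univ) w
  have hD : fderiv ℝ (fun p : ℝ × E => A p.1 p.2) (t, y) ((1 : ℝ), (0 : E)) w ∈
      skewAdjoint.submodule ℝ (Matrix m m ℂ) := by
    refine mem_submodule_of_hasDerivAt (Submodule.closed_of_finiteDimensional _) hd ?_
    filter_upwards [h𝒯.mem_nhds ht] with s hs
    exact hval hs y w
  rw [← hpde ht y w]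
  rw [← hd.deriv] at hD
  exact hD

omit [LinearOrder ι] in
/-- **The Laplacian of `|D^*F|²`.** For a `C⁴` `𝔲(m)`-valued connection whose divergence
`𝒟_w = div F(w)` is `𝔲(m)`-valued, and an orthonormal frame `b`:
`∑ᵢ ∂ᵢ∂ᵢ ∑ⱼ ‖𝒟ⱼ‖² = 2 ∑ᵢⱼ ‖Dᵢ𝒟ⱼ‖² + 2 ∑ᵢⱼ ⟨𝒟ⱼ, DᵢDᵢ𝒟ⱼ⟩` (covariant Leibniz rule twice).
[folklore] -/
theorem sum_fderiv_fderiv_divDensity_eq (b : OrthonormalBasis ι ℝ E)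
    {A : Connection E (Matrix m m ℂ)} (hA : ContDiff ℝ 4 A)
    (hval : A.IsValuedIn (skewAdjoint.submodule ℝ (Matrix m m ℂ))) (x : E) :
    ∑ i, fderiv ℝ (fun y => fderiv ℝ (fun z => ∑ j, ‖divCurvature A z (b j)‖ ^ 2) y (b i)) x (b i) =
      2 * ∑ i, ∑ j, ‖covDeriv A (fun z => divCurvature A z (b j)) x (b i)‖ ^ 2 +
        2 * ∑ i, ∑ j, ⟪divCurvature A x (b j),
          covDeriv A (fun y => covDeriv A (fun z => divCurvature A z (b j)) y (b i)) x (b i)⟫ := by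
  have hA1 : ContDiff ℝ 1 A := hA.of_le (by norm_num)
  have hA22 : ContDiff ℝ (2 + 2) A := by rw [show (2 : WithTop ℕ∞) + 2 = 4 by norm_num]; exact hA
  have hD2 : ∀ j, ContDiff ℝ 2 (fun z => divCurvature A z (b j)) := fun j =>
    contDiff_divCurvature_apply hA22 (b j)
  have hDd : ∀ j, Differentiable ℝ fun z => divCurvature A z (b j) := fun j =>
    (hD2 j).differentiable two_ne_zero
  have hDDd : ∀ i j, Differentiable ℝ fun y => covDeriv A (fun z => divCurvature A z (b j)) y (b i) :=
    fun i j y => differentiableAt_covDeriv_apply hA1 (hD2 j) (b i) y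
  -- first derivatives: `∂ᵢ ∑ⱼ ‖𝒟ⱼ‖² = ∑ⱼ 2⟨𝒟ⱼ, Dᵢ𝒟ⱼ⟩`
  have h1 : ∀ i, (fun y => fderiv ℝ (fun z => ∑ j, ‖divCurvature A z (b j)‖ ^ 2) y (b i)) =
      fun y => ∑ j, 2 * ⟪divCurvature A y (b j),
        covDeriv A (fun z => divCurvature A z (b j)) y (b i)⟫ := by
    intro i
    funext y
    rw [fderiv_fun_sum fun j _ => ((hDd j) y).norm_sq ℝ, FunLike.coe_sum, Finset.sum_apply]
    exact Finset.sum_congr rfl fun j _ =>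
      fderiv_norm_sq_eq_two_inner_covDeriv ((hDd j) y) (b i) (hval y (b i))
  simp_rw [h1]
  rw [Finset.mul_sum, Finset.mul_sum, ← Finset.sum_add_distrib]
  refine Finset.sum_congr rfl fun i _ => ?_
  have hterm : ∀ j, DifferentiableAt ℝ (fun y => 2 * ⟪divCurvature A y (b j),
      covDeriv A (fun z => divCurvature A z (b j)) y (b i)⟫) x := fun j =>
    (((hDd j) x).inner ℝ ((hDDd i j) x)).const_mul 2
  rw [fderiv_fun_sum fun j _ => hterm j, FunLike.coe_sum, Finset.sum_apply, Finset.mul_sum,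
    Finset.mul_sum, ← Finset.sum_add_distrib]
  refine Finset.sum_congr rfl fun j _ => ?_
  rw [fderiv_const_mul (((hDd j) x).inner ℝ ((hDDd i j) x)), smul_apply, smul_eq_mul,
    fderiv_frobenius_inner_eq_covDeriv ((hDd j) x) ((hDDd i j) x) (b i) (hval x (b i)),
    real_inner_self_eq_norm_sq]
  ring

omit [LinearOrder ι] in
/-- `(∑ⱼ aⱼ)² ≤ card · ∑ⱼ aⱼ²` (Cauchy–Schwarz). [folklore] -/
private theorem sq_sum_le_card_mul_sum_sq' (a : ι → ℝ) :
    (∑ j, a j) ^ 2 ≤ Fintype.card ι * ∑ j, a j ^ 2 := by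
  have h := sq_sum_le_card_mul_sum_sq (s := Finset.univ) (f := a)
  simpa using h

/-- **The Bochner inequality for `|D^*F|²` along the Yang–Mills heat flow** (flat space; Waldron
2016 Lemma 3.5: `(∂ₜ + ∇^*∇)D^*F_i = 2[F_{ij}, D^*F_j]`, then Moser). For a jointly smooth
`𝔲(m)`-valued solution on an open time set `𝒯 ∋ t` and an orthonormal frame `b`, with
`u = ∑ⱼ ‖div F(bⱼ)‖²` and `e = ymDensityOfBasis b`, at every `x`:
`∂ₜu − ∑ᵢ∂ᵢ∂ᵢu ≤ −2∑ᵢⱼ‖Dᵢ(div F(bⱼ))‖² + 8√2 (card ι) √e · u`. [cite: Waldron2016, Lemma 3.5;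
Waldron2019, Prop. 3.1(b)] -/
theorem deriv_divDensity_sub_laplacian_le (b : OrthonormalBasis ι ℝ E)
    {A : ℝ → Connection E (Matrix m m ℂ)} {𝒯 : Set ℝ} (h𝒯 : IsOpen 𝒯)
    (hA : ContDiffOn ℝ ∞ (fun p : ℝ × E => A p.1 p.2) (𝒯 ×ˢ (univ : Set E)))
    (hval : ∀ ⦃s : ℝ⦄, s ∈ 𝒯 → (A s).IsValuedIn (skewAdjoint.submodule ℝ (Matrix m m ℂ)))
    (hpde : ∀ ⦃s : ℝ⦄, s ∈ 𝒯 → ∀ y w, deriv (fun s' => A s' y w) s = divCurvature (A s) y w)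
    {t : ℝ} (ht : t ∈ 𝒯) (x : E) :
    deriv (fun s => ∑ j, ‖divCurvature (A s) x (b j)‖ ^ 2) t -
        ∑ i, fderiv ℝ (fun y => fderiv ℝ (fun z => ∑ j, ‖divCurvature (A t) z (b j)‖ ^ 2) y (b i))
          x (b i) ≤
      -(2 * ∑ i, ∑ j, ‖covDeriv (A t) (fun z => divCurvature (A t) z (b j)) x (b i)‖ ^ 2) +
        8 * Real.sqrt 2 * (Fintype.card ι : ℝ) * Real.sqrt (ymDensityOfBasis b (A t) x) *
          ∑ j, ‖divCurvature (A t) x (b j)‖ ^ 2 := by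
  have hsm : ContDiff ℝ ∞ (A t) := contDiff_slice_of_contDiffOn_prod hA ht
  have hA4 : ContDiff ℝ 4 (A t) := hsm.of_le (natCast_le_infty₆ 4)
  -- ### the time derivative of `u`
  set 𝒟 : ι → Matrix m m ℂ := fun j => divCurvature (A t) x (b j) with h𝒟
  set L : ι → Matrix m m ℂ := fun j =>
    ∑ i, covDeriv (A t) (fun y => covDeriv (A t) (fun z => divCurvature (A t) z (b j)) y (b i)) x
      (b i) with hL
  set Q : ι → Matrix m m ℂ := fun j =>
    ∑ i, ⁅curvature (A t) x (b j) (b i), divCurvature (A t) x (b i)⁆ with hQ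
  have hj : ∀ j, HasDerivAt (fun s => ‖divCurvature (A s) x (b j)‖ ^ 2)
      (2 * ⟪𝒟 j, L j + (2 : ℝ) • Q j⟫) t := fun j =>
    (hasDerivAt_divCurvature_of_flow b h𝒯 hA hpde ht x (b j)).norm_sq
  have hu : HasDerivAt (fun s => ∑ j, ‖divCurvature (A s) x (b j)‖ ^ 2)
      (∑ j, 2 * ⟪𝒟 j, L j + (2 : ℝ) • Q j⟫) t := HasDerivAt.fun_sum fun j _ => hj j
  rw [hu.deriv, sum_fderiv_fderiv_divDensity_eq b hA4 (hval ht) x]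
  -- ### bookkeeping: `∂ₜu − Δu = −2∑‖D𝒟‖² + 4 ∑ⱼ ⟨𝒟ⱼ, Qⱼ⟩`
  have e1 : ∑ j, 2 * ⟪𝒟 j, L j + (2 : ℝ) • Q j⟫ =
      2 * (∑ j, ⟪𝒟 j, L j⟫) + 4 * ∑ j, ⟪𝒟 j, Q j⟫ := by
    simp only [inner_add_right, inner_smul_right, mul_add, Finset.sum_add_distrib, ← Finset.mul_sum]
    ring
  have e2 : ∑ j, ⟪𝒟 j, L j⟫ = ∑ i, ∑ j, ⟪divCurvature (A t) x (b j),
      covDeriv (A t) (fun y => covDeriv (A t) (fun z => divCurvature (A t) z (b j)) y (b i))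
        x (b i)⟫ := by
    simp only [hL, h𝒟, inner_sum]
    exact Finset.sum_comm
  rw [e1, e2]
  -- ### the cubic term: `|⟨𝒟ⱼ, [F_{ji}, 𝒟ᵢ]⟩| ≤ 2√(2e) ‖𝒟ⱼ‖ ‖𝒟ᵢ‖`
  set ee : ℝ := ymDensityOfBasis b (A t) x with hee
  have hF : ∀ j i, ‖curvature (A t) x (b j) (b i)‖ ≤ Real.sqrt (2 * ee) := fun j i =>
    norm_curvature_apply_le_sqrt b (A t) x j i
  have hQj : ∀ j, ⟪𝒟 j, Q j⟫ ≤ 2 * Real.sqrt (2 * ee) * (‖𝒟 j‖ * ∑ i, ‖𝒟 i‖) := by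
    intro j
    simp only [hQ, inner_sum, Finset.mul_sum]
    refine Finset.sum_le_sum fun i _ => ?_
    calc ⟪𝒟 j, ⁅curvature (A t) x (b j) (b i), divCurvature (A t) x (b i)⁆⟫
        ≤ |⟪𝒟 j, ⁅curvature (A t) x (b j) (b i), divCurvature (A t) x (b i)⁆⟫| := le_abs_self _
      _ ≤ 2 * ‖𝒟 j‖ * ‖curvature (A t) x (b j) (b i)‖ * ‖divCurvature (A t) x (b i)‖ :=
          abs_frobenius_inner_lie_le _ _ _
      _ ≤ 2 * ‖𝒟 j‖ * Real.sqrt (2 * ee) * ‖divCurvature (A t) x (b i)‖ := by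
          gcongr; exact hF j i
      _ = 2 * Real.sqrt (2 * ee) * (‖𝒟 j‖ * ‖𝒟 i‖) := by simp only [h𝒟]; ring
  have hsumQ : ∑ j, ⟪𝒟 j, Q j⟫ ≤ 2 * Real.sqrt (2 * ee) * (∑ j, ‖𝒟 j‖) ^ 2 := by
    calc ∑ j, ⟪𝒟 j, Q j⟫ ≤ ∑ j, 2 * Real.sqrt (2 * ee) * (‖𝒟 j‖ * ∑ i, ‖𝒟 i‖) :=
          Finset.sum_le_sum fun j _ => hQj j
      _ = 2 * Real.sqrt (2 * ee) * (∑ j, ‖𝒟 j‖) ^ 2 := by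
          rw [← Finset.mul_sum, ← Finset.sum_mul, sq]
  have hCS : (∑ j, ‖𝒟 j‖) ^ 2 ≤ Fintype.card ι * ∑ j, ‖𝒟 j‖ ^ 2 :=
    sq_sum_le_card_mul_sum_sq' fun j => ‖𝒟 j‖
  have hsqrt : Real.sqrt (2 * ee) = Real.sqrt 2 * Real.sqrt ee :=
    Real.sqrt_mul (by norm_num) ee
  have hpos : 0 ≤ 2 * Real.sqrt (2 * ee) := by positivity
  have hfin : 4 * ∑ j, ⟪𝒟 j, Q j⟫ ≤
      8 * Real.sqrt 2 * (Fintype.card ι : ℝ) * Real.sqrt ee * ∑ j, ‖𝒟 j‖ ^ 2 := by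
    calc 4 * ∑ j, ⟪𝒟 j, Q j⟫ ≤ 4 * (2 * Real.sqrt (2 * ee) * (∑ j, ‖𝒟 j‖) ^ 2) := by
          gcongr
      _ ≤ 4 * (2 * Real.sqrt (2 * ee) * (Fintype.card ι * ∑ j, ‖𝒟 j‖ ^ 2)) := by
          gcongr
      _ = 8 * Real.sqrt 2 * (Fintype.card ι : ℝ) * Real.sqrt ee * ∑ j, ‖𝒟 j‖ ^ 2 := by
          rw [hsqrt]; ring
  simp only [h𝒟] at hfin
  linarith

end DivBochner

end Literature.MathematicalPhysics.QuantumLattice
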